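import Summits.AtomisticToContinuum.FouriersLaw.Theorems.HonestZwanzigRobinCoercivityDiagBound
import Summits.AtomisticToContinuum.FouriersLaw.Theorems.HonestZwanzigRobinCoercivityOhmOfBlockInputs
import Summits.AtomisticToContinuum.FouriersLaw.Theorems.HonestZwanzigRobinCoercivityPositiveMemoryOfBlockInputs

/-!
# `HonestZwanzig.RobinCoercivity`, line `limit-operator-memory-form` — what the shared inputs buy (summary corollaries)

Support file for the crux `stmt-AtomisticToContinuum-12695` (`RobinCoercivity`, route `HonestZwanzig`, sub-problem `FouriersLaw`).
The line's inputs, as named Props of `…LimitOperatorTransfer` / `…Residues` / `…DiagBound`: (U′) `BlockBandDomination`, (L)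
`BlockBulkLimit` (rev 2), `BlockDiagBound` (uniform diagonal bound) — all three of the rank-2 "locality / boundedness of the
orthogonal current memory" class and meant to be filed ONCE as support items shared by the cruxes stmt-12693 and stmt-12695 —,
and the two qualitative residues (Q1) `BulkSymbolPositivity`, (Q2) `CornerCoercivity`. Landed consequences, collected here as
one-line corollaries for the planners:
* `orthogonalOhm_of_blockInputs'` : (U′) → (L) → `BlockDiagBound` → `OrthogonalOhm` — the route's rank-2 crux AS TYPED is a corollary
  (`orthogonalOhm_of_blockInputs`, p169484, through `fluxRowBound_of_band_diag`, p168655);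
* `robinCoercivity_iff_residues'` (…DiagBound): (U′) → (L) → `BlockDiagBound` → (`RobinCoercivity` ↔ (Q1) ∧ (Q2));
* `cruxes_of_blockInputs` : (U′) → (L) → `BlockDiagBound` → (Q1) → (Q2) → `RobinCoercivity ∧ OrthogonalOhm` — with the three shared
  inputs and the two residues, BOTH rank-2 and rank-4 cruxes of the route close; (Q1) at `θ = 0` is the rank-3 crux `PositiveMemory`'s
  end (`symbolZero_pos_of_positiveMemory`, p154765) and its lower half `K̂ ≥ 0` is unconditional (`symbol_nonneg_of_bulkLimit`, p152997).
-/

noncomputable section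

open Summit.AtomisticToContinuum.FouriersLaw.Theses.HonestZwanzig

namespace Summit.AtomisticToContinuum.FouriersLaw.Theorems.HonestZwanzig.Robin

/-- **`OrthogonalOhm` from the three shared inputs** (band-domination, bulk limit, diagonal bound). -/
theorem orthogonalOhm_of_blockInputs' (hU : BlockBandDomination) (hL : BlockBulkLimit) (hD : BlockDiagBound) :
    OrthogonalOhm :=
  orthogonalOhm_of_blockInputs hU hL (fluxRowBound_of_band_diag hU hD)

/-- **Both cruxes from the shared inputs and the two residues.** -/
theorem cruxes_of_blockInputs (hU : BlockBandDomination) (hL : BlockBulkLimit) (hD : BlockDiagBound)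
    (hQ1 : BulkSymbolPositivity) (hQ2 : CornerCoercivity) : RobinCoercivity ∧ OrthogonalOhm :=
  ⟨(robinCoercivity_iff_residues' hU hL hD).2 ⟨hQ1, hQ2⟩, orthogonalOhm_of_blockInputs' hU hL hD⟩

/-- **All three open cruxes of route `HonestZwanzig` from the shared inputs and the two residues**: (U′) band-domination,
(L) bulk limit, the diagonal bound, (Q1) bulk symbol positivity and (Q2) corner coercivity give `OrthogonalOhm` (rank 2,
`orthogonalOhm_of_blockInputs'`), `PositiveMemory` (rank 3, `positiveMemory_of_blockInputs`, p169723 — (Q1) used at `θ = 0`) and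
`RobinCoercivity` (rank 4, the transfer theorem). So the route's entire remaining open content is S ∪ R =
{`BlockBandDomination`, `BlockBulkLimit`, `BlockDiagBound`} ∪ {`BulkSymbolPositivity`, `CornerCoercivity`}. -/
theorem allCruxes_of_blockInputs (hU : BlockBandDomination) (hL : BlockBulkLimit) (hD : BlockDiagBound)
    (hQ1 : BulkSymbolPositivity) (hQ2 : CornerCoercivity) : OrthogonalOhm ∧ PositiveMemory ∧ RobinCoercivity :=
  ⟨orthogonalOhm_of_blockInputs' hU hL hD, positiveMemory_of_blockInputs hU hL hQ1,
    (robinCoercivity_iff_residues' hU hL hD).2 ⟨hQ1, hQ2⟩⟩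

end Summit.AtomisticToContinuum.FouriersLaw.Theorems.HonestZwanzig.Robin

end
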